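import Literature.NumberTheory.Automorphic.LieAlgebraGLBracket
import Literature.NumberTheory.Automorphic.ZariskiGL
import HarnessLib

/-!
# A finite-index subgroup has the same Lie algebra: `Lie(H) = Lie(Γ)` for `[Γ : H] < ∞`
(trunk T-AUTOMORPHIC vocabulary of `LieAlgebraGL.lean`; theorems only)

For subgroups `H ≤ Γ ≤ GL n k` with `H` of finite index in `Γ` we prove
`lieAlgebraGL H = lieAlgebraGL Γ` (`lieAlgebraGL_eq_of_finiteIndex`, also for `lieSubalgebraGL`):
the Zariski closures `H̄ ≤ Γ̄` then have finite index too, hence the same identity component, and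
`Lie` only sees the identity component (Springer 4.4.6 / `lieAlgebraGL_identityComponent`;
Borel, *Linear Algebraic Groups*, 1.2 and 3.5).  This is the form of "`Lie` does not change on an
open subgroup" needed for images of Galois representations (`Γ = ρ(Γ_K)`, `H = ρ(Γ_F)` for a
finite extension `F/K`), e.g. to pass from `H`-stable subspaces to `Lie(Γ)`-stable ones
(`mulVec_mem_of_forall_mulVec_mem_of_finiteIndex`).

The proof given here is elementary and self-contained (no identity components, no dimension
theory): for `p ∈ 𝓘(H)` and `A ∈ Lie(Γ)` we build `F = p · ∏_{bad cosets gH ⊆ Γ} q_g(g⁻¹ ·)`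
vanishing on all of `Γ`, where a coset `gH` is *good* when `g` lies in the closure `H̄` (then `p`
already vanishes on `gH ⊆ H̄`, as `𝓘(H̄) = 𝓘(H)`) and *bad* otherwise, with `q_g ∈ 𝓘(H)` not
vanishing at `g⁻¹ ∉ H̄`; since `p(1) = 0`, Leibniz gives `dF_1 = (∏ q_g(g⁻¹)) · dp_1`, whence
`dp_1(A) = 0`.

Also recorded: `eval_eq_zero_of_mem_closure`, `vanishingIdeal_closure`
(`𝓘(closure Z) = 𝓘(Z)`), `exists_eval_ne_zero_of_notMem_closure`, and
`lieAlgebraGL_zariskiClosure : Lie(H̄) = Lie(H)` (Springer 4.4.5: the Lie algebra of a subgroup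
is that of its closure, by definition of `𝓘`).

Tree search: uses `lieAlgebraGL`, `mem_lieAlgebraGL_iff`, `lieAlgebraGL_mono`, `tangentDeriv_mul`
(`LieAlgebraGL.lean`, `LieAlgebraGLStabilizer.lean`), `lieSubalgebraGL` (`LieAlgebraGLBracket.lean`),
`zariskiClosure`, `zariskiTopologyGL`, `isClosed_zeroLocusGL`, `isClosed_zariski_iff`
(`ZariskiGL.lean`), `leftMulPolyGL`, `eval_leftMulPolyGL`, `mem_vanishingIdeal_glCoordFun_iff`
(`IdentityComponent.lean`), `mulVec_mem_of_forall_mulVec_mem` (`LieAlgebraGLStabilizer.lean`);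
nothing on finite-index subgroups and `Lie` was in the tree (`lieAlgebraGL_identityComponent`
treats the identity component of an *algebraic* subgroup).

## References

* T. A. Springer, *Linear Algebraic Groups*, 2nd ed. (1998), 2.2.1, 4.4.5, 4.4.6.
* A. Borel, *Linear Algebraic Groups*, 2nd ed. (1991), 1.2, 3.5.
-/

open MvPolynomial

namespace Literature.NumberTheory.Automorphic

variable {k : Type*} [Field k] {n : Type*} [Fintype n] [DecidableEq n]

-- The Zariski topology `zariskiTopologyGL n k` on `GL n k` is a `def` of `ZariskiGL.lean`; as
-- there, it is only ever used explicitly (`@closure _ (zariskiTopologyGL n k)`, `letI`).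

/-! ### Vanishing ideals and Lie algebras do not see the closure -/

/-- A polynomial vanishing on `Z` vanishes on the Zariski closure of `Z` (zero sets are closed).
[folklore] -/
theorem eval_eq_zero_of_mem_closure {Z : Set (GL n k)} {p : MvPolynomial (GLCoord n) k}
    (hp : p ∈ vanishingIdeal k (glCoordFun '' Z)) {x : GL n k}
    (hx : x ∈ @closure _ (zariskiTopologyGL n k) Z) : eval (glCoordFun x) p = 0 := by
  letI := zariskiTopologyGL n k
  have hZ : Z ⊆ zeroLocusGL ({p} : Set (MvPolynomial (GLCoord n) k)) := fun g hg q hq => by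
    rw [Set.mem_singleton_iff] at hq
    subst hq
    exact mem_vanishingIdeal_glCoordFun_iff.1 hp g hg
  exact closure_minimal hZ (isClosed_zeroLocusGL _) hx p rfl

/-- **`𝓘(Z̄) = 𝓘(Z)`**: a subset of `GL n k` and its Zariski closure have the same vanishing ideal
(Springer 1.1.2). [folklore] -/
theorem vanishingIdeal_closure (Z : Set (GL n k)) :
    vanishingIdeal k (glCoordFun '' @closure _ (zariskiTopologyGL n k) Z) =
      vanishingIdeal k (glCoordFun '' Z) :=
  letI := zariskiTopologyGL n k
  le_antisymm (vanishingIdeal_anti_mono (Set.image_mono subset_closure)) fun _ hp =>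
    mem_vanishingIdeal_glCoordFun_iff.2 fun _ hx => eval_eq_zero_of_mem_closure hp hx

/-- A point outside the Zariski closure of `Z` is separated from `Z` by a polynomial of `𝓘(Z)`.
[folklore] -/
theorem exists_eval_ne_zero_of_notMem_closure {Z : Set (GL n k)} {x : GL n k}
    (hx : x ∉ @closure _ (zariskiTopologyGL n k) Z) :
    ∃ p ∈ vanishingIdeal k (glCoordFun '' Z), eval (glCoordFun x) p ≠ 0 := by
  letI := zariskiTopologyGL n k
  by_contra h
  push Not at h
  apply hx
  obtain ⟨S, hS⟩ := isClosed_zariski_iff.1 (isClosed_closure (s := Z))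
  rw [hS]
  intro p hp
  refine h p (mem_vanishingIdeal_glCoordFun_iff.2 fun g hg => ?_)
  have hg' : g ∈ zeroLocusGL S := hS ▸ subset_closure hg
  exact hg' p hp

/-- **`Lie(H̄) = Lie(H)`**: the Lie algebra of a subgroup is that of its Zariski closure (both are
cut out by the same ideal `𝓘(H̄) = 𝓘(H)`; Springer 4.4.5). [cite: SpringerLAG1998, 4.4.5] -/
theorem lieAlgebraGL_zariskiClosure (H : Subgroup (GL n k)) :
    lieAlgebraGL (zariskiClosure H) = lieAlgebraGL H := by
  ext A
  rw [mem_lieAlgebraGL_iff, mem_lieAlgebraGL_iff, coe_zariskiClosure, vanishingIdeal_closure]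

/-- `Lie(H̄) = Lie(H)` as Lie subalgebras of `𝔤𝔩ₙ`. [cite: SpringerLAG1998, 4.4.5] -/
theorem lieSubalgebraGL_zariskiClosure (H : Subgroup (GL n k)) :
    lieSubalgebraGL (zariskiClosure H) = lieSubalgebraGL H :=
  SetLike.ext fun A => by
    rw [mem_lieSubalgebraGL_iff, mem_lieSubalgebraGL_iff, lieAlgebraGL_zariskiClosure]

/-! ### Finite-index subgroups -/

/-- **A finite-index subgroup has the same Lie algebra**: for subgroups `H ≤ Γ` of `GL n k` with
`[Γ : H] < ∞`, `Lie(H) = Lie(Γ)` (the closures have the same identity component and `Lie` only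
sees the identity component, Springer 4.4.6; elementary proof in the module docstring).
[cite: SpringerLAG1998, 4.4.6] -/
theorem lieAlgebraGL_eq_of_finiteIndex {H Γ : Subgroup (GL n k)} (hle : H ≤ Γ)
    [hfi : (H.subgroupOf Γ).FiniteIndex] : lieAlgebraGL H = lieAlgebraGL Γ := by
  classical
  letI := zariskiTopologyGL n k
  refine le_antisymm (lieAlgebraGL_mono hle) fun A hA => ?_
  rw [mem_lieAlgebraGL_iff] at hA ⊢
  intro p hp
  set K : Subgroup Γ := H.subgroupOf Γ
  haveI : Finite (Γ ⧸ K) := Subgroup.finite_quotient_of_finiteIndex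
  haveI : Fintype (Γ ⧸ K) := Fintype.ofFinite _
  -- the coset of `c` consists of the `x ∈ Γ` with `(c.out)⁻¹ x ∈ H`
  have hcoset : ∀ (c : Γ ⧸ K) (x : GL n k) (hx : x ∈ Γ), ((⟨x, hx⟩ : Γ) : Γ ⧸ K) = c →
      ((c.out : Γ) : GL n k)⁻¹ * x ∈ H := by
    intro c x hx hxc
    have hmem : (c.out : Γ)⁻¹ * ⟨x, hx⟩ ∈ K := by
      rw [← QuotientGroup.eq, QuotientGroup.out_eq']
      exact hxc.symm
    exact Subgroup.mem_subgroupOf.mp hmem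
  -- one auxiliary polynomial per coset: `1` for good cosets, `q_g(g⁻¹ ·)` for bad ones
  have key : ∀ c : Γ ⧸ K, ∃ φ : MvPolynomial (GLCoord n) k,
      eval (glCoordFun (1 : GL n k)) φ ≠ 0 ∧
        ∀ (x : GL n k) (hx : x ∈ Γ), ((⟨x, hx⟩ : Γ) : Γ ⧸ K) = c →
          eval (glCoordFun x) p = 0 ∨ eval (glCoordFun x) φ = 0 := by
    intro c
    by_cases hg : ((c.out : Γ) : GL n k) ∈ zariskiClosure H
    · refine ⟨1, by simp, fun x hx hxc => Or.inl ?_⟩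
      have hxcl : x ∈ zariskiClosure H := by
        have h := (zariskiClosure H).mul_mem hg (le_zariskiClosure H (hcoset c x hx hxc))
        rwa [mul_inv_cancel_left] at h
      exact eval_eq_zero_of_mem_closure hp hxcl
    · have hg' : ((c.out : Γ) : GL n k)⁻¹ ∉ closure (H : Set (GL n k)) := fun h =>
        hg ((zariskiClosure H).inv_mem_iff.1 h)
      obtain ⟨q, hq, hq0⟩ := exists_eval_ne_zero_of_notMem_closure hg'
      refine ⟨bind₁ (leftMulPolyGL ((c.out : Γ) : GL n k)⁻¹) q, ?_, fun x hx hxc => Or.inr ?_⟩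
      · rw [eval_bind₁]
        have hfun : (fun i => eval (glCoordFun (1 : GL n k))
            (leftMulPolyGL ((c.out : Γ) : GL n k)⁻¹ i)) = glCoordFun ((c.out : Γ) : GL n k)⁻¹ := by
          funext i; rw [eval_leftMulPolyGL, mul_one]
        rwa [hfun]
      · rw [eval_bind₁]
        have hfun : (fun i => eval (glCoordFun x) (leftMulPolyGL ((c.out : Γ) : GL n k)⁻¹ i)) =
            glCoordFun (((c.out : Γ) : GL n k)⁻¹ * x) := by
          funext i; rw [eval_leftMulPolyGL]
        rw [hfun]
        exact mem_vanishingIdeal_glCoordFun_iff.1 hq _ (hcoset c x hx hxc)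
  choose φ hφ1 hφ2 using key
  have hF : p * ∏ c, φ c ∈ vanishingIdeal k (glCoordFun '' (Γ : Set (GL n k))) := by
    refine mem_vanishingIdeal_glCoordFun_iff.2 fun x hx => ?_
    rw [map_mul, map_prod]
    rcases hφ2 _ x hx rfl with h | h
    · rw [h, zero_mul]
    · exact mul_eq_zero_of_right _ (Finset.prod_eq_zero (Finset.mem_univ _) h)
  have h1 := hA _ hF
  have hp1 : eval (glCoordFun (1 : GL n k)) p = 0 :=
    mem_vanishingIdeal_glCoordFun_iff.1 hp 1 H.one_mem
  rw [tangentDeriv_mul, map_prod, hp1, zero_mul, zero_add] at h1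
  exact (mul_eq_zero.mp h1).resolve_right (Finset.prod_ne_zero_iff.mpr fun c _ => hφ1 c)

/-- `Lie(H) = Lie(Γ)` for `H ≤ Γ` of finite index, as Lie subalgebras of `𝔤𝔩ₙ`.
[cite: SpringerLAG1998, 4.4.6] -/
theorem lieSubalgebraGL_eq_of_finiteIndex {H Γ : Subgroup (GL n k)} (hle : H ≤ Γ)
    [(H.subgroupOf Γ).FiniteIndex] : lieSubalgebraGL H = lieSubalgebraGL Γ :=
  SetLike.ext fun A => by
    rw [mem_lieSubalgebraGL_iff, mem_lieSubalgebraGL_iff, lieAlgebraGL_eq_of_finiteIndex hle]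

/-- The finite-index form with `relIndex`: `H.relIndex Γ ≠ 0` gives `Lie(H) = Lie(Γ)`.
[cite: SpringerLAG1998, 4.4.6] -/
theorem lieAlgebraGL_eq_of_relIndex_ne_zero {H Γ : Subgroup (GL n k)} (hle : H ≤ Γ)
    (hind : H.relIndex Γ ≠ 0) : lieAlgebraGL H = lieAlgebraGL Γ :=
  haveI : (H.subgroupOf Γ).FiniteIndex := ⟨hind⟩
  lieAlgebraGL_eq_of_finiteIndex hle

/-- **An `H`-stable subspace, `H` of finite index in `Γ`, is `Lie(Γ)`-stable** (the dictionary
"`Γ_F`-stable ⇒ `𝔤`-stable" for open subgroups of images of Galois representations;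
`mulVec_mem_of_forall_mulVec_mem` after `lieAlgebraGL_eq_of_finiteIndex`). [folklore] -/
theorem mulVec_mem_of_forall_mulVec_mem_of_finiteIndex {H Γ : Subgroup (GL n k)} (hle : H ≤ Γ)
    [(H.subgroupOf Γ).FiniteIndex] {W : Submodule k (n → k)}
    (hW : ∀ g ∈ H, ∀ w ∈ W, (g : Matrix n n k).mulVec w ∈ W) {A : Matrix n n k}
    (hA : A ∈ lieAlgebraGL Γ) {w : n → k} (hw : w ∈ W) : A.mulVec w ∈ W := by
  rw [← lieAlgebraGL_eq_of_finiteIndex hle] at hA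
  exact mulVec_mem_of_forall_mulVec_mem hW hA hw

end Literature.NumberTheory.Automorphic
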